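import Summits.CriticalPhenomena.SAWScalingLimit.Theses.SAWTotalPositivity

/-!
# Negative-side results for the crux `SAWTotalPositivity.TPToTraversalBound` (stmt-CriticalPhenomena-10687):
logic of the glue, load-bearing analysis, and the junk audit of its conclusion (H1)

Refuter `cdisprove` (standing adversary, cycles 1–3); the full indexed work file is
`Summits/CriticalPhenomena/SAWScalingLimit/Cruxes/TPToTraversalBound/Disproof.lean` (§1, §2, §4, §5 there).

Certified here (axioms standard):
* `iff_imp`, `not_crux_iff`: the crux IS the implication `BoundaryTP2 → CriticalBubbleBound →
  SAWTraversalBound`, so `¬ crux ↔ TP ∧ B ∧ ¬(H1)` — a disproof needs a PROOF of circular TP₂, a PROOF of the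
  critical bubble bound (open since Madras–Slade 1993) and a DISPROOF of the Aizenman–Burchard hypothesis (H1)
  for the critical SAW (believed true); conversely `¬TP` or `¬B` would close the crux vacuously (work file
  `of_not_tp`, `of_not_bubble`) — the disprover of this crux is also a disprover of the route.
* load-bearing: every dropped-hypothesis variant implies the crux and its negation contains `¬(H1)`
  (`not_traversalBound_of_not_without`) — no `_false_without_` certificate can exist unless (H1) fails.
* junk audit of (H1) = `SAWTraversalBound`: the threshold may be raised above any prescribed function
  (`traversalBound_iff_threshold_ge` — forced crossings refute nothing), the SAW law has mass ≤ 1 whatever the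
  junk conventions (`law_apply_le_one`), and the all-`δ` form of (H1) is EQUIVALENT to the eventual form
  (`allMesh_iff`) — unlike tightness, where the all-`δ` form was refuted (stmt-CriticalPhenomena-0772).
* the two natural strengthenings `ConstThresholdTraversalBound` (AB99's printed shell-independent threshold)
  and `UniformTraversalBound` (constants uniform in the domain) both imply (H1); they are FALSE on paper
  (oscillating prime end / winding corridors, work file §5), which only confirms the typing of (H1).
-/

namespace Summit.CriticalPhenomena.SAWScalingLimit.Theorems.TPToTraversalBound.Negative

open Summit.CriticalPhenomena.SAWScalingLimit.Theses.SAWTotalPositivity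
open Literature.Probability.RandomPlanarGeometry Literature.Probability.LatticeModels MeasureTheory

/-! ## §1 Logic of the crux: it is the glue `TP → B → (H1)` -/

/-- The crux is literally the implication `BoundaryTP2 → CriticalBubbleBound → SAWTraversalBound`. [folklore] -/
theorem iff_imp :
    TPToTraversalBound ↔ (BoundaryTP2 → CriticalBubbleBound → SAWTraversalBound) := Iff.rfl

/-- A disproof of the crux is EXACTLY a proof of TP₂, a proof of the bubble bound, and a disproof of
(H1) for the critical SAW. [folklore] -/
theorem not_crux_iff :
    ¬ TPToTraversalBound ↔ BoundaryTP2 ∧ CriticalBubbleBound ∧ ¬ SAWTraversalBound := by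
  constructor
  · intro h
    by_contra h'
    apply h
    intro htp hb
    by_contra hH
    exact h' ⟨htp, hb, hH⟩
  · rintro ⟨htp, hb, hH⟩ h
    exact hH (h htp hb)

/-! ## §2 Load-bearing analysis: the crux with a hypothesis dropped

Each variant trivially implies the crux (`fun h _ hb => h hb`, `fun h htp _ => h htp`, `fun h _ _ => h`), as does
any proof of (H1) and — ex falso — any refutation of TP₂ or of the bubble bound; these one-liners are left to the
work file (`of_traversalBound`, `of_not_tp`, `of_not_bubble`, `of_without*`). -/

/-- The crux with TP₂ dropped. -/
def WithoutTP : Prop := CriticalBubbleBound → SAWTraversalBound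

/-- The crux with the bubble bound dropped. -/
def WithoutBubble : Prop := BoundaryTP2 → SAWTraversalBound

/-- The crux with both hypotheses dropped: (H1) itself. -/
def WithoutBoth : Prop := SAWTraversalBound

/-- `¬ WithoutTP` is a proof of the bubble bound together with a disproof of (H1). [folklore] -/
theorem not_withoutTP_iff : ¬ WithoutTP ↔ CriticalBubbleBound ∧ ¬ SAWTraversalBound :=
  Classical.not_imp

/-- `¬ WithoutBubble` is a proof of TP₂ together with a disproof of (H1). [folklore] -/
theorem not_withoutBubble_iff : ¬ WithoutBubble ↔ BoundaryTP2 ∧ ¬ SAWTraversalBound :=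
  Classical.not_imp

/-- `¬ WithoutBoth` is a disproof of (H1). [folklore] -/
theorem not_withoutBoth_iff : ¬ WithoutBoth ↔ ¬ SAWTraversalBound := Iff.rfl

/-- Hence every conceivable `_false_without_` theorem for this crux CONTAINS a disproof of (H1) for
the critical square-lattice SAW — a statement believed true (SLE_{8/3} picture); no load-bearing
certificate can exist unless (H1) fails. [folklore] -/
theorem not_traversalBound_of_not_without
    (h : ¬ WithoutTP ∨ ¬ WithoutBubble ∨ ¬ WithoutBoth) : ¬ SAWTraversalBound := by
  rcases h with h | h | h
  · exact (not_withoutTP_iff.1 h).2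
  · exact (not_withoutBubble_iff.1 h).2
  · exact h

/-! ## §4 The conclusion's threshold may be raised at will (no `k`-loophole, room for forced crossings) -/

/-- The `k`-traversal event shrinks as `k` grows, hence so does its SAW probability. [folklore] -/
theorem law_hasTraversals_anti {Ω : Set ℂ} {δ : ℝ} {u v : Site 2} {j k : ℕ} (hjk : j ≤ k)
    (x : ℂ) (ρ R : ℝ) :
    SAW.law Ω δ u v {γ | (⟨γ.walk.toCurve (meshPoint δ)⟩ : Curve ℂ).HasTraversals k x ρ R}
      ≤ SAW.law Ω δ u v {γ | (⟨γ.walk.toCurve (meshPoint δ)⟩ : Curve ℂ).HasTraversals j x ρ R} :=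
  measure_mono fun _ hγ => Curve.HasTraversals.of_le hγ hjk

/-- (H1) is equivalent to (H1) with the threshold function required to dominate ANY prescribed
function `k₀ : ℂ → ℝ → ℝ → ℕ` (e.g. the deterministic forced-crossing count of the domain near its
marked prime ends).  So the shell-dependence of `k` absorbs every geometric forcing, and a refutation
can never come from forced crossings alone. [folklore] -/
theorem traversalBound_iff_threshold_ge :
    SAWTraversalBound ↔ ∀ (k₀ : ℂ → ℝ → ℝ → ℕ) (D : DobrushinDomain) (a b : ℝ → Site 2),
      SAW.IsEndpointApprox D a b →
      ∃ (k : ℂ → ℝ → ℝ → ℕ) (K lam δ₀ : ℝ), (∀ x ρ R, k₀ x ρ R ≤ k x ρ R) ∧ 0 ≤ K ∧ 2 < lam ∧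
        0 < δ₀ ∧ ∀ δ ∈ Set.Ioc (0 : ℝ) δ₀, ∀ (x : ℂ) (ρ R : ℝ), δ ≤ ρ → ρ < R → R ≤ 1 →
          SAW.law D.carrier δ (a δ) (b δ)
              {γ | (⟨γ.walk.toCurve (meshPoint δ)⟩ : Curve ℂ).HasTraversals (k x ρ R) x ρ R}
            ≤ ENNReal.ofReal (K * (ρ / R) ^ lam) := by
  constructor
  · intro h k₀ D a b hab
    obtain ⟨k, K, lam, δ₀, hK, hlam, hδ₀, hb⟩ := h D a b hab
    refine ⟨fun x ρ R => max (k₀ x ρ R) (k x ρ R), K, lam, δ₀, fun x ρ R => le_max_left _ _, hK,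
      hlam, hδ₀, ?_⟩
    intro δ hδ x ρ R h1 h2 h3
    exact (law_hasTraversals_anti (le_max_right _ _) x ρ R).trans (hb δ hδ x ρ R h1 h2 h3)
  · intro h D a b hab
    obtain ⟨k, K, lam, δ₀, -, hK, hlam, hδ₀, hb⟩ := h (fun _ _ _ => 0) D a b hab
    exact ⟨k, K, lam, δ₀, hK, hlam, hδ₀, hb⟩

/-- The all-`δ` form of (H1) (no `δ₀`: every `δ ∈ (0,1]`) FOLLOWS from the eventual form whenever
the bound is allowed to be re-scaled by `δ₀^{-λ}` — the `K`-absorption of F2(ii): on `δ ∈ (δ₀, 1]`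
one has `ρ/R ≥ δ₀`, so `K' = max K δ₀^{-λ}` (with `K' ≥ 1 ≥` any probability) works.  Stated here
as the pointwise arithmetic fact used. [folklore] -/
theorem one_le_rescaled_bound {K lam δ₀ ρ R : ℝ} (hlam : 0 ≤ lam) (hδ₀ : 0 < δ₀)
    (hρ : δ₀ ≤ ρ) (hρR : ρ < R) (hR : R ≤ 1) :
    1 ≤ max K (δ₀ ^ (-lam)) * (ρ / R) ^ lam := by
  have hρ0 : 0 < ρ := hδ₀.trans_le hρ
  have hR0 : 0 < R := hρ0.trans hρR
  have hq : δ₀ ≤ ρ / R := by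
    rw [le_div_iff₀ hR0]
    nlinarith
  have hq1 : (ρ / R) ^ lam ≥ δ₀ ^ lam := Real.rpow_le_rpow hδ₀.le hq hlam
  have hinv : δ₀ ^ (-lam) * δ₀ ^ lam = 1 := by
    rw [Real.rpow_neg hδ₀.le, inv_mul_cancel₀ (Real.rpow_pos_of_pos hδ₀ lam).ne']
  calc (1 : ℝ) = δ₀ ^ (-lam) * δ₀ ^ lam := hinv.symm
    _ ≤ max K (δ₀ ^ (-lam)) * (ρ / R) ^ lam := by
        apply mul_le_mul (le_max_right _ _) hq1 (Real.rpow_nonneg hδ₀.le _)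
        exact le_trans (Real.rpow_nonneg hδ₀.le _) (le_max_right _ _)

/-- Whatever the junk conventions (`law = 0` if no SAW joins the endpoints or if the total weight
is infinite), the SAW law gives mass at most `1` to every event. [folklore] -/
theorem law_apply_le_one (Ω : Set ℂ) (δ : ℝ) (u v : Site 2) (S : Set (SAW.DomainSAW Ω δ u v)) :
    SAW.law Ω δ u v S ≤ 1 := by
  calc SAW.law Ω δ u v S ≤ SAW.law Ω δ u v Set.univ := measure_mono (Set.subset_univ _)
    _ = (SAW.weight Ω δ u v Set.univ)⁻¹ * SAW.weight Ω δ u v Set.univ := by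
        rw [SAW.law, Measure.smul_apply, smul_eq_mul]
    _ ≤ 1 := ENNReal.inv_mul_le_one _

/-- (H1) demanded for EVERY mesh `δ ∈ (0, 1]` (no `δ₀`), all other quantifiers as in
`SAWTraversalBound`. -/
def AllMeshTraversalBound : Prop :=
  ∀ (D : DobrushinDomain) (a b : ℝ → Site 2), SAW.IsEndpointApprox D a b →
    ∃ (k : ℂ → ℝ → ℝ → ℕ) (K lam : ℝ), 0 ≤ K ∧ 2 < lam ∧
      ∀ δ ∈ Set.Ioc (0 : ℝ) 1, ∀ (x : ℂ) (ρ R : ℝ), δ ≤ ρ → ρ < R → R ≤ 1 →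
        SAW.law D.carrier δ (a δ) (b δ)
            {γ | (⟨γ.walk.toCurve (meshPoint δ)⟩ : Curve ℂ).HasTraversals (k x ρ R) x ρ R}
          ≤ ENNReal.ofReal (K * (ρ / R) ^ lam)

/-- CERTIFIED: unlike tightness (where the all-`δ` form `Tight` was refuted, stmt-0772, and only the
eventual form survives), the all-`δ` form of (H1) is EQUIVALENT to the eventual form: for
`δ > δ₀` one has `ρ/R ≥ δ₀`, and the constant `max K δ₀^{-λ}` makes the bound `≥ 1 ≥` any
probability (`one_le_rescaled_bound`, `law_apply_le_one`).  So no all-`δ` junk attack exists on the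
conclusion of this crux. [folklore] -/
theorem allMesh_iff : AllMeshTraversalBound ↔ SAWTraversalBound := by
  constructor
  · intro h D a b hab
    obtain ⟨k, K, lam, hK, hlam, hb⟩ := h D a b hab
    exact ⟨k, K, lam, 1, hK, hlam, one_pos, hb⟩
  · intro h D a b hab
    obtain ⟨k, K, lam, δ₀, hK, hlam, hδ₀, hb⟩ := h D a b hab
    refine ⟨k, max K (δ₀ ^ (-lam)), lam, le_trans hK (le_max_left _ _), hlam, ?_⟩
    intro δ hδ x ρ R h1 h2 h3
    have hρ0 : 0 < ρ := hδ.1.trans_le h1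
    have hR0 : 0 < R := hρ0.trans h2
    by_cases hδδ₀ : δ ≤ δ₀
    · refine (hb δ ⟨hδ.1, hδδ₀⟩ x ρ R h1 h2 h3).trans (ENNReal.ofReal_le_ofReal ?_)
      exact mul_le_mul_of_nonneg_right (le_max_left _ _) (Real.rpow_nonneg (div_pos hρ0 hR0).le _)
    · have hlt : δ₀ < δ := not_le.1 hδδ₀
      calc SAW.law D.carrier δ (a δ) (b δ)
              {γ | (⟨γ.walk.toCurve (meshPoint δ)⟩ : Curve ℂ).HasTraversals (k x ρ R) x ρ R}
            ≤ 1 := law_apply_le_one _ _ _ _ _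
        _ ≤ ENNReal.ofReal (max K (δ₀ ^ (-lam)) * (ρ / R) ^ lam) :=
            ENNReal.one_le_ofReal.2
              (one_le_rescaled_bound (by linarith) hδ₀ (hlt.le.trans h1) h2 h3)

/-! ## §5 Natural strengthenings of (H1): the shell-independent-threshold and the uniform-in-`(D,a,b)` forms
(both FALSE on paper — witnesses in the work file's docstrings — and both imply (H1), so their falsity costs the
crux nothing; only the definitions and the certified implications are landed here) -/

/-- (H1) with a SHELL-INDEPENDENT threshold `k : ℕ` — the printed form of Aizenman–Burchard (1.3) —
quantified exactly like `SAWTraversalBound` otherwise. -/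
def ConstThresholdTraversalBound : Prop :=
  ∀ (D : DobrushinDomain) (a b : ℝ → Site 2), SAW.IsEndpointApprox D a b →
    ∃ (k : ℕ) (K lam δ₀ : ℝ), 0 ≤ K ∧ 2 < lam ∧ 0 < δ₀ ∧
      ∀ δ ∈ Set.Ioc (0 : ℝ) δ₀, ∀ (x : ℂ) (ρ R : ℝ), δ ≤ ρ → ρ < R → R ≤ 1 →
        SAW.law D.carrier δ (a δ) (b δ)
            {γ | (⟨γ.walk.toCurve (meshPoint δ)⟩ : Curve ℂ).HasTraversals k x ρ R}
          ≤ ENNReal.ofReal (K * (ρ / R) ^ lam)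

/-- (H1) with constants uniform in the Dobrushin domain and the endpoint approximation. -/
def UniformTraversalBound : Prop :=
  ∃ (k : ℂ → ℝ → ℝ → ℕ) (K lam δ₀ : ℝ), 0 ≤ K ∧ 2 < lam ∧ 0 < δ₀ ∧
    ∀ (D : DobrushinDomain) (a b : ℝ → Site 2), SAW.IsEndpointApprox D a b →
      ∀ δ ∈ Set.Ioc (0 : ℝ) δ₀, ∀ (x : ℂ) (ρ R : ℝ), δ ≤ ρ → ρ < R → R ≤ 1 →
        SAW.law D.carrier δ (a δ) (b δ)
            {γ | (⟨γ.walk.toCurve (meshPoint δ)⟩ : Curve ℂ).HasTraversals (k x ρ R) x ρ R}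
          ≤ ENNReal.ofReal (K * (ρ / R) ^ lam)

/-- Sanity (certified): the uniform form would imply (H1), so its falsity costs the crux nothing.
[folklore] -/
theorem traversalBound_of_uniform (h : UniformTraversalBound) : SAWTraversalBound := by
  obtain ⟨k, K, lam, δ₀, hK, hlam, hδ₀, hb⟩ := h
  exact fun D a b hab => ⟨k, K, lam, δ₀, hK, hlam, hδ₀, hb D a b hab⟩

/-- Sanity (certified): the constant-threshold form would imply (H1). [folklore] -/
theorem traversalBound_of_constThreshold (h : ConstThresholdTraversalBound) : SAWTraversalBound := by
  intro D a b hab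
  obtain ⟨k, K, lam, δ₀, hK, hlam, hδ₀, hb⟩ := h D a b hab
  exact ⟨fun _ _ _ => k, K, lam, δ₀, hK, hlam, hδ₀, hb⟩

end Summit.CriticalPhenomena.SAWScalingLimit.Theorems.TPToTraversalBound.Negative
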